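import Literature.AnabelianGeometry.SemiGraphs.ProSigmaUnmarkedNodeMalnormal
import Literature.AnabelianGeometry.SemiGraphs.PSCTwoComponentPointedProp12
import HarnessLib

/-!
# [CombGC] Prop. 1.2 (ii) at two-component data with `C₁` UNMARKED: node, cusps and the unmarked vertex

Mochizuki, *A combinatorial version of the Grothendieck conjecture*, Tohoku Math. J. **59** (2007)
[CombGC], Prop. 1.2 (ii) p. 8 [cite: MochizukiCombGC2007, Prop 1.2(ii) p.8]: "the `Aᵢ` [verticial and
edge-like subgroups] are commensurably terminal in `Π_G`".  abc-iut FACT-LIST row F-0438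
`PSCDatum.CommensurableTerminalityHolds` (schema over `Ω : PSCOrigin`, abc-iut-L3-t4; universal closure
refuted, instance forms at genuine carriers are the content).

PROOF-ONLY file (abc-iut-f-166 gen 5) for the data of two-component shape with the second component
UNMARKED (abc-iut-f-164 gen 2, `PSCTwoComponentUnmarkedOrigin.lean`: `C₀ ∪_ν C₁` over a pro-`Σ` completion
`ι : Γ_{g,r} → Π`, ALL `r ≥ 1` marked points on `C₀`, `C₁` a closed curve of genus `g − g₀ ≥ 1`; node group
`Π_ν = cl ι⟨ε⟩`, `ε = (c_0⋯c_{r−1}) ∏_{i<g₀}[a_i,b_i] = (∏_{i≥g₀}[a_i,b_i])⁻¹`, a member of no free basis of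
`Γ_{g,r}`).  With the malnormality of `Π_ν` (`ProSigmaUnmarkedNodeMalnormal.lean`: `Π_ν` is the closed
boundary cusp of the free factor `cl ι⟨a_i, b_i : i ≥ g₀⟩ ≅ Γ_{g−g₀,1}^∧`):

* `nodeGp_isCommensurablyTerminal_of_twoComponentUnmarked` — the node group is commensurably terminal;
* `cuspGp_isCommensurablyTerminal_of_cuspInertia` — the cusp groups (abc-iut-L3-t4's cusp engine);
* `vertGp₁_isCommensurablyTerminal_of_twoComponentUnmarked` — `Π_{v₁} = cl ι⟨a_i, b_i (i≥g₀), ε⟩ =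
  cl ι⟨a_i, b_i : i ≥ g₀⟩`, a free-factor closure (abc-iut-L5-t6's engine; `closure_secondSubsurface_eq_of_unmarked`);
* `edgeLike_commensurator_eq_of_twoComponentUnmarked`, `twoComponentUnmarkedOrigin_edgeLike_commensurator_eq`
  — the EDGE-LIKE HALF of Prop. 1.2 (ii)'s first clause, hypothesis-free, datum-wise and at every origin of
  such data (gen 2's origin hypothesis BY NAME);
* `verticialEdgeLikeCommensurablyTerminal_of_twoComponentUnmarked_of_vertGp₀`,
  `commensurablyTerminal_of_twoComponentUnmarked_of_vertGp₀` — the first clause, resp. BOTH clauses (sturdy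
  `Π^unr`-clause = abc-iut-f-164's `unrRows_of_twoComponent`), GIVEN the commensurable terminality of
  `Π_{v₀} = cl ι⟨a_i, b_i (i<g₀), c_0..c_{r−1}⟩` — the one vertex group that is NOT the closure of a free
  factor (row «UNMARKED-CT» of abc-iut-f-164 gen 5), to be supplied BY NAME.

Instance forms at data of the shape of genuine two-component curves: consistency evidence for the typed
schema, not the printed theorem for all pointed stable curves (cell FOUNDATIONS rows 13–14).  0 definitions;
nothing here takes a side on [IUTchIII] Cor. 3.12.
-/

noncomputable section

open scoped Pointwise

namespace Literature.AnabelianGeometry.SemiGraphs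

open Literature.GroupTheory.CombinatorialGroupTheory
open Literature.GroupTheory.CombinatorialGroupTheory.PuncturedSurfaceGroup (a b c cuspInertia
  exists_freeGroupBasis_elim_zero nodeLoop_eq_inv_of_unmarked)
open SemiGraphOfAnabelioids (IsProSigmaCompletion cuspInertia_closure_isCommensurablyTerminal)
open SemiGraphOfAnabelioids.IsProSigmaCompletion (freeFactor_isCommensurablyTerminal
  isCommensurablyTerminal_of_inf_conj_eq_bot commensurator_smul_eq_smul)

/-! ### The PSC datum: node, cusps and the free-factor vertex at two-component data with `C₁` unmarked -/

namespace PSCDatum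

section Datum

variable {P : Type} [Group P] [TopologicalSpace P] [IsTopologicalGroup P]
variable [CompactSpace P] [T2Space P] [TotallyDisconnectedSpace P] {Sigma : Set ℕ} {g r : ℕ}

/-- **The node group of an unmarked-`C₁` two-component datum is MALNORMAL in `Π_G`**: `Π_ν ∩ xΠ_νx⁻¹ = 1`
for every `x ∉ Π_ν` (and `Π_ν` is infinite).  Shape hypotheses of `PSCTwoComponentUnmarkedOrigin.lean`
(`s = 0`, `g − g₀ ≥ 1`, `r ≥ 1`); `Π_ν = cl ι⟨ε⟩ = cl ι⟨w⟩`, `w = ∏_{i≥g₀}[a_i,b_i] = ε⁻¹`.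
[cite: MochizukiCombGC2007, Prop 1.2(ii) p.8] -/
theorem nodeGp_infinite_and_inf_conj_eq_bot_of_twoComponentUnmarked (hne : Sigma.Nonempty)
    (hprime : ∀ p ∈ Sigma, p.Prime) (ι : PuncturedSurfaceGroup g r →* P)
    (hι : IsProSigmaCompletion Sigma ι) (G : PSCDatum P) {g₀ s : ℕ} (hg₀ : g₀ ≤ g) (hs : s = 0)
    (hr : 1 ≤ r) (hg₁ : 1 ≤ g - g₀) (ε : PuncturedSurfaceGroup g r)
    (hε : ε = ((List.finRange r).map fun j : Fin r =>
          if s ≤ (j : ℕ) then PuncturedSurfaceGroup.c (g := g) j else 1).prod *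
        ((List.finRange g).map fun i : Fin g => if (i : ℕ) < g₀ then
          PuncturedSurfaceGroup.a (r := r) i * PuncturedSurfaceGroup.b i *
            (PuncturedSurfaceGroup.a i)⁻¹ * (PuncturedSurfaceGroup.b i)⁻¹ else 1).prod)
    (n₀ : G.graph.N) (hE : G.nodeGp n₀ = ((Subgroup.zpowers ε).map ι).topologicalClosure) :
    Infinite (G.nodeGp n₀) ∧
      ∀ x : P, x ∉ G.nodeGp n₀ → G.nodeGp n₀ ⊓ ConjAct.toConjAct x • G.nodeGp n₀ = ⊥ := by
  subst hs
  obtain ⟨g₁, rfl⟩ : ∃ g₁, g = g₀ + g₁ := ⟨g - g₀, by omega⟩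
  obtain ⟨r', rfl⟩ : ∃ r', r = r' + 1 := ⟨r - 1, by omega⟩
  have hw := nodeLoop_eq_inv_of_unmarked (g := g₀ + g₁) (r := r' + 1) g₀ ε hε
  have hE' : G.nodeGp n₀ = ((Subgroup.zpowers (((List.finRange (g₀ + g₁)).map fun i : Fin (g₀ + g₁) =>
      if g₀ ≤ (i : ℕ) then PuncturedSurfaceGroup.a (r := r' + 1) i * PuncturedSurfaceGroup.b i *
        (PuncturedSurfaceGroup.a i)⁻¹ * (PuncturedSurfaceGroup.b i)⁻¹ else 1).prod)).map
          ι).topologicalClosure := by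
    rw [hE, hw, Subgroup.zpowers_inv]
  rw [hE']
  exact secondHandleProd_closure_infinite_and_inf_conj_eq_bot hne hprime (by omega) ι hι

/-- **[CombGC] Prop. 1.2 (ii) for the NODE at two-component data with `C₁` unmarked**: every nodal
subgroup representative `Π_ν` is commensurably terminal in `Π_G` (an infinite malnormal subgroup is
commensurably terminal). [cite: MochizukiCombGC2007, Prop 1.2(ii) p.8] -/
theorem nodeGp_isCommensurablyTerminal_of_twoComponentUnmarked (hne : Sigma.Nonempty)
    (hprime : ∀ p ∈ Sigma, p.Prime) (ι : PuncturedSurfaceGroup g r →* P)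
    (hι : IsProSigmaCompletion Sigma ι) (G : PSCDatum P) {g₀ s : ℕ} (hg₀ : g₀ ≤ g) (hs : s = 0)
    (hr : 1 ≤ r) (hg₁ : 1 ≤ g - g₀) (ε : PuncturedSurfaceGroup g r)
    (hε : ε = ((List.finRange r).map fun j : Fin r =>
          if s ≤ (j : ℕ) then PuncturedSurfaceGroup.c (g := g) j else 1).prod *
        ((List.finRange g).map fun i : Fin g => if (i : ℕ) < g₀ then
          PuncturedSurfaceGroup.a (r := r) i * PuncturedSurfaceGroup.b i *
            (PuncturedSurfaceGroup.a i)⁻¹ * (PuncturedSurfaceGroup.b i)⁻¹ else 1).prod)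
    (n₀ : G.graph.N) (hN : ∀ n, n = n₀)
    (hE : G.nodeGp n₀ = ((Subgroup.zpowers ε).map ι).topologicalClosure) (n : G.graph.N) :
    AbsoluteAnabelian.IsCommensurablyTerminal (G.nodeGp n) := by
  rw [hN n]
  obtain ⟨hinf, hmal⟩ := G.nodeGp_infinite_and_inf_conj_eq_bot_of_twoComponentUnmarked hne hprime ι hι
    hg₀ hs hr hg₁ ε hε n₀ hE
  haveI := hinf
  exact isCommensurablyTerminal_of_inf_conj_eq_bot hmal

omit [IsTopologicalGroup P] in
/-- **[CombGC] Prop. 1.2 (ii) for the CUSPS** of a datum whose cusp groups are the closed cusp inertia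
groups of a pro-`Σ` completion of a hyperbolic `Γ_{g,r}` (abc-iut-L3-t4's cusp engine, restated in the
shape vocabulary). [cite: MochizukiCombGC2007, Prop 1.2(ii) p.8] -/
theorem cuspGp_isCommensurablyTerminal_of_cuspInertia [IsTopologicalGroup P] (hne : Sigma.Nonempty)
    (hprime : ∀ p ∈ Sigma, p.Prime) (ι : PuncturedSurfaceGroup g r →* P)
    (hι : IsProSigmaCompletion Sigma ι) (G : PSCDatum P) (hhyp : PuncturedSurfaceGroup.IsHyperbolicType g r)
    (e : G.graph.C ≃ Fin r)
    (hC : ∀ c', G.cuspGp c' = ((cuspInertia (g := g) (e c')).map ι).topologicalClosure) (c' : G.graph.C) :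
    AbsoluteAnabelian.IsCommensurablyTerminal (G.cuspGp c') := by
  rw [hC]
  exact cuspInertia_closure_isCommensurablyTerminal hne hprime hhyp ι hι (e c')

/-- The second subsurface group at `s = 0`: `⟨a_i, b_i (i ≥ g₀), (no cusps), ε⟩ = ⟨b₀(x) : x = (i,·), i ≥ g₀⟩`
for the `c_0`-eliminating basis `b₀` — since `ε = (∏_{i≥g₀}[a_i,b_i])⁻¹`.
[cite: MochizukiSemiAnbd2006, Ex. 2.10 p.31] -/
theorem closure_secondSubsurface_eq_of_unmarked {g₀ g₁ r' : ℕ}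
    (b₀ : FreeGroupBasis ((Fin (g₀ + g₁) × Bool) ⊕ Fin r') (PuncturedSurfaceGroup (g₀ + g₁) (r' + 1)))
    (ha : ∀ i, b₀ (Sum.inl (i, false)) = PuncturedSurfaceGroup.a i)
    (hb : ∀ i, b₀ (Sum.inl (i, true)) = PuncturedSurfaceGroup.b i)
    (ε : PuncturedSurfaceGroup (g₀ + g₁) (r' + 1))
    (hε : ε = ((List.finRange (r' + 1)).map fun j : Fin (r' + 1) =>
          if 0 ≤ (j : ℕ) then PuncturedSurfaceGroup.c (g := g₀ + g₁) j else 1).prod *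
        ((List.finRange (g₀ + g₁)).map fun i : Fin (g₀ + g₁) => if (i : ℕ) < g₀ then
          PuncturedSurfaceGroup.a (r := r' + 1) i * PuncturedSurfaceGroup.b i *
            (PuncturedSurfaceGroup.a i)⁻¹ * (PuncturedSurfaceGroup.b i)⁻¹ else 1).prod) :
    Subgroup.closure {x : PuncturedSurfaceGroup (g₀ + g₁) (r' + 1) |
        (∃ i : Fin (g₀ + g₁), g₀ ≤ (i : ℕ) ∧ (x = PuncturedSurfaceGroup.a i ∨ x = PuncturedSurfaceGroup.b i)) ∨
        (∃ j : Fin (r' + 1), (j : ℕ) < 0 ∧ x = PuncturedSurfaceGroup.c j) ∨ x = ε} =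
      Subgroup.closure (b₀ '' {x | Sum.elim (fun p : Fin (g₀ + g₁) × Bool => g₀ ≤ (p.1 : ℕ))
        (fun _ : Fin r' => False) x}) := by
  classical
  set S₁ : Set ((Fin (g₀ + g₁) × Bool) ⊕ Fin r') :=
    {x | Sum.elim (fun p : Fin (g₀ + g₁) × Bool => g₀ ≤ (p.1 : ℕ)) (fun _ : Fin r' => False) x} with hS₁
  have haR : ∀ i : Fin (g₀ + g₁), g₀ ≤ (i : ℕ) →
      PuncturedSurfaceGroup.a (r := r' + 1) i ∈ Subgroup.closure (b₀ '' S₁) := fun i hi =>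
    Subgroup.subset_closure ⟨Sum.inl (i, false), hi, ha i⟩
  have hbR : ∀ i : Fin (g₀ + g₁), g₀ ≤ (i : ℕ) →
      PuncturedSurfaceGroup.b (r := r' + 1) i ∈ Subgroup.closure (b₀ '' S₁) := fun i hi =>
    Subgroup.subset_closure ⟨Sum.inl (i, true), hi, hb i⟩
  have hεR : ε ∈ Subgroup.closure (b₀ '' S₁) := by
    rw [nodeLoop_eq_inv_of_unmarked g₀ ε hε]
    exact Subgroup.inv_mem _ (PuncturedSurfaceGroup.comm_prod_ite_mem _ _ haR hbR)
  apply le_antisymm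
  · rw [Subgroup.closure_le]
    rintro x (⟨i, hi, rfl | rfl⟩ | ⟨j, hj, rfl⟩ | rfl)
    · exact haR i hi
    · exact hbR i hi
    · exact absurd hj (Nat.not_lt_zero _)
    · exact hεR
  · rw [Subgroup.closure_le]
    rintro _ ⟨y, hy, rfl⟩
    rcases y with ⟨i, _ | _⟩ | j
    · exact Subgroup.subset_closure (Or.inl ⟨i, hy, Or.inl (ha i)⟩)
    · exact Subgroup.subset_closure (Or.inl ⟨i, hy, Or.inr (hb i)⟩)
    · exact absurd hy (by simp [hS₁])

/-- **[CombGC] Prop. 1.2 (ii) for the UNMARKED component's vertex group** `Π_{v₁} = cl ι⟨a_i, b_i (i ≥ g₀), ε⟩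
= cl ι⟨a_i, b_i : i ≥ g₀⟩`, the closure of a FREE FACTOR: commensurably terminal by abc-iut-L5-t6's
`freeFactor_isCommensurablyTerminal`. [cite: MochizukiCombGC2007, Prop 1.2(ii) p.8] -/
theorem vertGp₁_isCommensurablyTerminal_of_twoComponentUnmarked (hne : Sigma.Nonempty)
    (hprime : ∀ p ∈ Sigma, p.Prime) (ι : PuncturedSurfaceGroup g r →* P)
    (hι : IsProSigmaCompletion Sigma ι) (G : PSCDatum P) {g₀ s : ℕ} (hg₀ : g₀ ≤ g) (hs : s = 0)
    (hr : 1 ≤ r) (hg₁ : 1 ≤ g - g₀) (v₁ : G.graph.V) (ε : PuncturedSurfaceGroup g r)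
    (hε : ε = ((List.finRange r).map fun j : Fin r =>
          if s ≤ (j : ℕ) then PuncturedSurfaceGroup.c (g := g) j else 1).prod *
        ((List.finRange g).map fun i : Fin g => if (i : ℕ) < g₀ then
          PuncturedSurfaceGroup.a (r := r) i * PuncturedSurfaceGroup.b i *
            (PuncturedSurfaceGroup.a i)⁻¹ * (PuncturedSurfaceGroup.b i)⁻¹ else 1).prod)
    (hV₁ : G.vertGp v₁ = ((Subgroup.closure {x : PuncturedSurfaceGroup g r |
        (∃ i : Fin g, g₀ ≤ (i : ℕ) ∧ (x = PuncturedSurfaceGroup.a i ∨ x = PuncturedSurfaceGroup.b i)) ∨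
        (∃ j : Fin r, (j : ℕ) < s ∧ x = PuncturedSurfaceGroup.c j) ∨ x = ε}).map ι).topologicalClosure) :
    AbsoluteAnabelian.IsCommensurablyTerminal (G.vertGp v₁) := by
  subst hs
  obtain ⟨g₁, rfl⟩ : ∃ g₁, g = g₀ + g₁ := ⟨g - g₀, by omega⟩
  obtain ⟨r', rfl⟩ : ∃ r', r = r' + 1 := ⟨r - 1, by omega⟩
  have hp : ∃ p ∈ Sigma, p.Prime := hne.imp fun p hp => ⟨hp, hprime p hp⟩
  obtain ⟨b₀, ha, hb, -⟩ := exists_freeGroupBasis_elim_zero (g₀ + g₁) r'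
  rw [hV₁, closure_secondSubsurface_eq_of_unmarked b₀ ha hb ε hε]
  exact freeFactor_isCommensurablyTerminal b₀ _
    ⟨Sum.inl (⟨g₀, by omega⟩, false), show g₀ ≤ g₀ from le_rfl⟩ hι hp

/-- **[CombGC] Prop. 1.2 (ii), FIRST clause, at every two-component datum with `C₁` unmarked, GIVEN the
commensurable terminality of `Π_{v₀}`** (the vertex group `cl ι⟨a_i, b_i (i<g₀), c_0..c_{r−1}⟩`, NOT the
closure of a free factor — abc-iut-f-164 gen 5's row): node by malnormality (this file), cusps by the cusp
engine, `Π_{v₁}` as a free-factor closure. [cite: MochizukiCombGC2007, Prop 1.2(ii) p.8] -/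
theorem verticialEdgeLikeCommensurablyTerminal_of_twoComponentUnmarked_of_vertGp₀ (hne : Sigma.Nonempty)
    (hprime : ∀ p ∈ Sigma, p.Prime) (ι : PuncturedSurfaceGroup g r →* P)
    (hι : IsProSigmaCompletion Sigma ι) (G : PSCDatum P) {g₀ s : ℕ} (hg₀ : g₀ ≤ g) (hs : s = 0)
    (hr : 1 ≤ r) (hg₁ : 1 ≤ g - g₀) (e : G.graph.C ≃ Fin r)
    (hC : ∀ c', G.cuspGp c' = ((cuspInertia (g := g) (e c')).map ι).topologicalClosure)
    (v₀ v₁ : G.graph.V) (hV : ∀ w, w = v₀ ∨ w = v₁) (ε : PuncturedSurfaceGroup g r)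
    (hε : ε = ((List.finRange r).map fun j : Fin r =>
          if s ≤ (j : ℕ) then PuncturedSurfaceGroup.c (g := g) j else 1).prod *
        ((List.finRange g).map fun i : Fin g => if (i : ℕ) < g₀ then
          PuncturedSurfaceGroup.a (r := r) i * PuncturedSurfaceGroup.b i *
            (PuncturedSurfaceGroup.a i)⁻¹ * (PuncturedSurfaceGroup.b i)⁻¹ else 1).prod)
    (hV₁ : G.vertGp v₁ = ((Subgroup.closure {x : PuncturedSurfaceGroup g r |
        (∃ i : Fin g, g₀ ≤ (i : ℕ) ∧ (x = PuncturedSurfaceGroup.a i ∨ x = PuncturedSurfaceGroup.b i)) ∨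
        (∃ j : Fin r, (j : ℕ) < s ∧ x = PuncturedSurfaceGroup.c j) ∨ x = ε}).map ι).topologicalClosure)
    (n₀ : G.graph.N) (hN : ∀ n, n = n₀)
    (hE : G.nodeGp n₀ = ((Subgroup.zpowers ε).map ι).topologicalClosure)
    (h₀ : AbsoluteAnabelian.IsCommensurablyTerminal (G.vertGp v₀)) :
    G.VerticialEdgeLikeCommensurablyTerminal := by
  have hhyp : PuncturedSurfaceGroup.IsHyperbolicType g r := by
    unfold PuncturedSurfaceGroup.IsHyperbolicType; omega
  refine G.verticialEdgeLikeCommensurablyTerminal_of (fun v => ?_)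
    (G.nodeGp_isCommensurablyTerminal_of_twoComponentUnmarked hne hprime ι hι hg₀ hs hr hg₁ ε hε n₀ hN hE)
    (G.cuspGp_isCommensurablyTerminal_of_cuspInertia hne hprime ι hι hhyp e hC)
  rcases hV v with rfl | rfl
  · exact h₀
  · exact G.vertGp₁_isCommensurablyTerminal_of_twoComponentUnmarked hne hprime ι hι hg₀ hs hr hg₁ v ε hε
      hV₁

/-- **[CombGC] Prop. 1.2 (ii), BOTH clauses, at every two-component datum with `C₁` unmarked, GIVEN the
commensurable terminality of `Π_{v₀}`**: the first clause as above, the sturdy `Π^unr`-clause by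
abc-iut-f-164's `unrRows_of_twoComponent` (genus pins). [cite: MochizukiCombGC2007, Prop 1.2(ii) p.8] -/
theorem commensurablyTerminal_of_twoComponentUnmarked_of_vertGp₀ (hne : Sigma.Nonempty)
    (hprime : ∀ p ∈ Sigma, p.Prime) (ι : PuncturedSurfaceGroup g r →* P)
    (hι : IsProSigmaCompletion Sigma ι) (G : PSCDatum P) {g₀ s : ℕ} (hg₀ : g₀ ≤ g) (hs : s = 0)
    (hr : 1 ≤ r) (hg₁ : 1 ≤ g - g₀) (e : G.graph.C ≃ Fin r)
    (hC : ∀ c', G.cuspGp c' = ((cuspInertia (g := g) (e c')).map ι).topologicalClosure)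
    (v₀ v₁ : G.graph.V) (hV : ∀ w, w = v₀ ∨ w = v₁) (ε : PuncturedSurfaceGroup g r)
    (hε : ε = ((List.finRange r).map fun j : Fin r =>
          if s ≤ (j : ℕ) then PuncturedSurfaceGroup.c (g := g) j else 1).prod *
        ((List.finRange g).map fun i : Fin g => if (i : ℕ) < g₀ then
          PuncturedSurfaceGroup.a (r := r) i * PuncturedSurfaceGroup.b i *
            (PuncturedSurfaceGroup.a i)⁻¹ * (PuncturedSurfaceGroup.b i)⁻¹ else 1).prod)
    (hV₀ : G.vertGp v₀ = ((Subgroup.closure {x : PuncturedSurfaceGroup g r |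
        (∃ i : Fin g, (i : ℕ) < g₀ ∧ (x = PuncturedSurfaceGroup.a i ∨ x = PuncturedSurfaceGroup.b i)) ∨
        ∃ j : Fin r, s ≤ (j : ℕ) ∧ x = PuncturedSurfaceGroup.c j}).map ι).topologicalClosure)
    (hV₁ : G.vertGp v₁ = ((Subgroup.closure {x : PuncturedSurfaceGroup g r |
        (∃ i : Fin g, g₀ ≤ (i : ℕ) ∧ (x = PuncturedSurfaceGroup.a i ∨ x = PuncturedSurfaceGroup.b i)) ∨
        (∃ j : Fin r, (j : ℕ) < s ∧ x = PuncturedSurfaceGroup.c j) ∨ x = ε}).map ι).topologicalClosure)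
    (n₀ : G.graph.N) (hN : ∀ n, n = n₀)
    (hE : G.nodeGp n₀ = ((Subgroup.zpowers ε).map ι).topologicalClosure)
    (hgen₀ : G.genus v₀ = g₀) (hgen₁ : G.genus v₁ = g - g₀)
    (h₀ : AbsoluteAnabelian.IsCommensurablyTerminal (G.vertGp v₀)) :
    G.VerticialEdgeLikeCommensurablyTerminal ∧ G.UnrVerticialCommensurablyTerminal :=
  ⟨G.verticialEdgeLikeCommensurablyTerminal_of_twoComponentUnmarked_of_vertGp₀ hne hprime ι hι hg₀ hs hr
      hg₁ e hC v₀ v₁ hV ε hε hV₁ n₀ hN hE h₀,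
    (G.unrRows_of_twoComponent hne hprime ι hι e hC n₀ hN v₀ v₁ hV ε hε hV₀ hV₁ hE hgen₀ hgen₁).2.2⟩

/-- **The EDGE-LIKE half of [CombGC] Prop. 1.2 (ii) at every two-component datum with `C₁` unmarked**,
hypothesis-free: every edge-like subgroup (nodal or cuspidal) is commensurably terminal in `Π_G`.
[cite: MochizukiCombGC2007, Prop 1.2(ii) p.8] -/
theorem edgeLike_commensurator_eq_of_twoComponentUnmarked (hne : Sigma.Nonempty)
    (hprime : ∀ p ∈ Sigma, p.Prime) (ι : PuncturedSurfaceGroup g r →* P)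
    (hι : IsProSigmaCompletion Sigma ι) (G : PSCDatum P) {g₀ s : ℕ} (hg₀ : g₀ ≤ g) (hs : s = 0)
    (hr : 1 ≤ r) (hg₁ : 1 ≤ g - g₀) (e : G.graph.C ≃ Fin r)
    (hC : ∀ c', G.cuspGp c' = ((cuspInertia (g := g) (e c')).map ι).topologicalClosure)
    (ε : PuncturedSurfaceGroup g r)
    (hε : ε = ((List.finRange r).map fun j : Fin r =>
          if s ≤ (j : ℕ) then PuncturedSurfaceGroup.c (g := g) j else 1).prod *
        ((List.finRange g).map fun i : Fin g => if (i : ℕ) < g₀ then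
          PuncturedSurfaceGroup.a (r := r) i * PuncturedSurfaceGroup.b i *
            (PuncturedSurfaceGroup.a i)⁻¹ * (PuncturedSurfaceGroup.b i)⁻¹ else 1).prod)
    (n₀ : G.graph.N) (hN : ∀ n, n = n₀)
    (hE : G.nodeGp n₀ = ((Subgroup.zpowers ε).map ι).topologicalClosure)
    (A : Subgroup P) (hA : G.IsEdgeLike A) : Subgroup.Commensurable.commensurator A = A := by
  have hhyp : PuncturedSurfaceGroup.IsHyperbolicType g r := by
    unfold PuncturedSurfaceGroup.IsHyperbolicType; omega
  rcases hA with ⟨n, γ, rfl⟩ | ⟨c', γ, rfl⟩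
  · exact commensurator_smul_eq_smul
      (G.nodeGp_isCommensurablyTerminal_of_twoComponentUnmarked hne hprime ι hι hg₀ hs hr hg₁ ε hε n₀ hN hE n) γ
  · exact commensurator_smul_eq_smul (G.cuspGp_isCommensurablyTerminal_of_cuspInertia hne hprime ι hι hhyp e hC c') γ

end Datum

/-! ### Origin level: the edge-like half of F-0438's first clause at every unmarked-`C₁` origin -/

/-- **The edge-like half of F-0438 `CommensurableTerminalityHolds Ω`'s first clause at EVERY origin whose
data are of two-component shape with `C₁` unmarked** (abc-iut-f-164 gen 2's origin hypothesis of
`PSCTwoComponentUnmarkedOrigin.lean` BY NAME): all edge-like subgroups are commensurably terminal; the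
verticial half for `Π_{v₁}` is `vertGp₁_isCommensurablyTerminal_of_twoComponentUnmarked`, for `Π_{v₀}` it
is abc-iut-f-164 gen 5's row. [cite: MochizukiCombGC2007, Prop 1.2(ii) p.8] -/
theorem twoComponentUnmarkedOrigin_edgeLike_commensurator_eq (Ω : PSCOrigin.{0})
    (hΩ : ∀ ⦃Q : Type⦄ [Group Q] [TopologicalSpace Q] [IsTopologicalGroup Q] (G : PSCDatum Q),
      Ω.IsOfPSCType G → CompactSpace Q ∧ T2Space Q ∧ TotallyDisconnectedSpace Q ∧
        ∃ (S : Set ℕ) (g r g₀ s : ℕ) (ι : PuncturedSurfaceGroup g r →* Q) (e : G.graph.C ≃ Fin r)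
          (v₀ v₁ : G.graph.V) (n₀ : G.graph.N) (ε : PuncturedSurfaceGroup g r),
          S.Nonempty ∧ (∀ p ∈ S, p.Prime) ∧ IsProSigmaCompletion S ι ∧ g₀ ≤ g ∧ s = 0 ∧ 1 ≤ r ∧
          (1 ≤ g₀ ∨ 2 ≤ r) ∧ 1 ≤ g - g₀ ∧
          (∀ c, G.cuspGp c =
            ((PuncturedSurfaceGroup.cuspInertia (g := g) (e c)).map ι).topologicalClosure) ∧
          (∀ w, w = v₀ ∨ w = v₁) ∧ (∀ n, n = n₀) ∧
          ε = ((List.finRange r).map fun j : Fin r =>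
            if s ≤ (j : ℕ) then PuncturedSurfaceGroup.c (g := g) j else 1).prod *
          ((List.finRange g).map fun i : Fin g => if (i : ℕ) < g₀ then
            PuncturedSurfaceGroup.a (r := r) i * PuncturedSurfaceGroup.b i *
              (PuncturedSurfaceGroup.a i)⁻¹ * (PuncturedSurfaceGroup.b i)⁻¹ else 1).prod ∧
          G.vertGp v₀ = ((Subgroup.closure {x : PuncturedSurfaceGroup g r |
            (∃ i : Fin g, (i : ℕ) < g₀ ∧ (x = PuncturedSurfaceGroup.a i ∨ x = PuncturedSurfaceGroup.b i)) ∨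
            ∃ j : Fin r, s ≤ (j : ℕ) ∧ x = PuncturedSurfaceGroup.c j}).map ι).topologicalClosure ∧
          G.vertGp v₁ = ((Subgroup.closure {x : PuncturedSurfaceGroup g r |
            (∃ i : Fin g, g₀ ≤ (i : ℕ) ∧ (x = PuncturedSurfaceGroup.a i ∨ x = PuncturedSurfaceGroup.b i)) ∨
            (∃ j : Fin r, (j : ℕ) < s ∧ x = PuncturedSurfaceGroup.c j) ∨ x = ε}).map ι).topologicalClosure ∧
          G.nodeGp n₀ = ((Subgroup.zpowers ε).map ι).topologicalClosure ∧
          G.genus v₀ = g₀ ∧ G.genus v₁ = g - g₀) :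
    ∀ ⦃Q : Type⦄ [Group Q] [TopologicalSpace Q] [IsTopologicalGroup Q] (G : PSCDatum Q),
      Ω.IsOfPSCType G → ∀ A : Subgroup Q, G.IsEdgeLike A → Subgroup.Commensurable.commensurator A = A := by
  intro Q _ _ _ G hG A hA
  obtain ⟨hc, ht, hd, S, g, r, g₀, s, ι, e, v₀, v₁, n₀, ε, hne, hprime, hι, hg₀, hs, hr, -, hg₁, hC,
    -, hN, hε, -, -, hE, -, -⟩ := hΩ G hG
  haveI := hc
  haveI := ht
  haveI := hd
  exact G.edgeLike_commensurator_eq_of_twoComponentUnmarked hne hprime ι hι hg₀ hs hr hg₁ e hC ε hε n₀ hN hE A hA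

end PSCDatum

end Literature.AnabelianGeometry.SemiGraphs

end
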